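import Literature.MathematicalPhysics.QuantumLattice.HubbardTwoPointMatsubaraSeries
import Literature.MathematicalPhysics.QuantumLattice.ShiftedHubbardTwoPointDeterminant
import HarnessLib

/-!
# The Grassmann two-point limit matrix against the shifted Hamiltonian two-point word: the match on the simplex

Topic `MathematicalPhysics/QuantumLattice`; the two-point level of the `M → ∞` ("Matsubara UV") bridge, matching part
(after `HubbardTwoPointMatsubaraSeries` for the limit series and `ShiftedHubbardTwoPointDeterminant` for the Hamiltonian
side).  With vertex times `τ_a = β(1 − u_a)` (`u` strictly increasing, `u_a < 1`) and external time `0`, the limiting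
Wick matrix of `ψ⁺_{(x⃗ₑ,0)σ}ψ⁻_{(y⃗ₑ,0)σ'}Vⁿ` is `ε_i ε_j` times the shifted Hamiltonian word matrix
`twoPointWordMatrix = propMatrix(c†_{x⃗ₑσ}c_{y⃗ₑσ'} ∏(n_{x_a↑}−½)(n_{x_a↓}−½)(−βu_a)) − diag(0,½,…,½)`, `ε = (−1,1,…,1)`
(antiperiodicity moves the external time from `β` to `0`), except at the external pair where the symmetric-truncation
midpoint `½ − n_F` replaces the `n_F`-type entry of `c†c`: correction `½[σ=σ'][x⃗ₑ=y⃗ₑ]`: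

* `sum_torusChar_neg_of_even`, `vertexLimitEntry_swap` (the band is even); `propMatrix_torus_orb_apply₂`
  (independent creation / annihilation orbitals), `hubbardWordOrb_eq`; scalar matches `timeOrdered_row_eq`,
  `timeOrdered_col_eq`, `twoPoint_corner_eq`;
* `twoPointWordMatrix`, `vacuumWordMatrix` (defs), `twoPointWordMatrix_succ_succ`;
* `twoPointLimit_entry_{zero_zero,zero_succ,succ_zero,succ_succ}`, **`twoPointLimit_entry_eq`**;
* `det_sub_corner` (`det(A − cE₀₀) = det A − c·det A₁₁`), `det_cons_sign_mul`;
* **`twoPointLimitDet_reflect_eq`** — `twoPointLimitDet x (β(1−u)) = det(twoPointWordMatrix x u) − ½[σ=σ'][x⃗ₑ=y⃗ₑ]·det(vacuumWordMatrix x u)`.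

## Sources

G. Benfatto, A. Giuliani, V. Mastropietro, Ann. Henri Poincaré 7 (2006) 809–898 = arXiv:cond-mat/0507686, §1.2
(1.2)–(1.4), §2.1 (2.3)–(2.8) [`BenfattoGiulianiMastropietro2006`].
-/

noncomputable section

namespace Literature.MathematicalPhysics.QuantumLattice

open GrassmannAlgebra Finset Filter _root_.MeasureTheory Literature.Probability.LatticeModels _root_.Topology NormedSpace
open scoped Nat Pointwise ComplexOrder

/-! ### D. The match with the shifted Hamiltonian two-point word on the simplex -/

section Match

variable {L : ℕ} [NeZero L]

/-- `χ_{−q}(−z) = χ_q(z)`. [folklore] -/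
theorem torusChar_neg_neg (q z : TorusSite 2 L) : torusChar (-q) (-z) = torusChar q z := by
  simp [torusChar]

/-- Character sums with an EVEN symbol do not see the orientation: `Σ_q χ_q(−z) g(q) = Σ_q χ_q(z) g(q)` if
`g(−q) = g(q)`. [folklore] -/
theorem sum_torusChar_neg_of_even (z : TorusSite 2 L) (g : TorusSite 2 L → ℂ) (hg : ∀ q, g (-q) = g q) :
    ∑ q : TorusSite 2 L, torusChar q (-z) * g q = ∑ q : TorusSite 2 L, torusChar q z * g q := by
  refine Fintype.sum_equiv (Equiv.neg (TorusSite 2 L)) _ _ fun q => ?_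
  rw [Equiv.neg_apply, hg]
  have h := torusChar_neg_neg (-q) z
  rw [neg_neg] at h
  rw [h]

/-- **The limiting entries are symmetric under exchanging the two legs' sites and spins** (the band is even:
`ξ_{−q} = ξ_q`). [folklore] -/
theorem vertexLimitEntry_swap (β μ : ℝ) (xa xb : TorusSite 2 L) (σ σ' : Fin 2) (s : ℝ) :
    vertexLimitEntry L β μ xa xb σ σ' s = vertexLimitEntry L β μ xb xa σ' σ s := by
  rw [vertexLimitEntry_eq_torusChar, vertexLimitEntry_eq_torusChar]
  by_cases hσ : σ = σ'
  · subst hσ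
    simp only [if_true]
    congr 2
    rw [show xa - xb = -(xb - xa) by abel]
    exact sum_torusChar_neg_of_even _ _ fun q => by simp only [nambuXi, torusBand_neg]
  · rw [if_neg hσ, if_neg (Ne.symm hσ)]

/-- **The time-ordered propagator matrix of the torus, independent creation / annihilation orbitals** (`L ≥ 3`):
for pairs `m` with creation orbital `(y⁺_m, σ⁺_m)`, annihilation orbital `(y⁻_m, σ⁻_m)` and times `s_m`,
`propMatrix(a,b) = [σ⁻_b=σ⁺_a] L⁻² Σ_k χ_k(y⁻_b − y⁺_a) e^{-(s_b−s_a)(ε_k−μ)} f_β(ε_k−μ)` if `a ≤ b` and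
`−[σ⁻_b=σ⁺_a] L⁻² Σ_k χ_k(y⁻_b − y⁺_a) e^{-(s_b−s_a)(ε_k−μ)} f_{−β}(ε_k−μ)` otherwise.
[cite: BenfattoGiulianiMastropietro2006, §1.2 (1.4)] -/
theorem propMatrix_torus_orb_apply₂ (hL : 3 ≤ L) (β μ : ℝ) {N : ℕ} (yp ym : Fin N → FermionTorus 2 L)
    (σp σm : Fin N → Fin 2) (s : Fin N → ℂ) (a b : Fin N) :
    propMatrix β (hubbardOneBody (fermionTorusGraph 2 L) 1 μ) (fun m => orb (yp m) (σp m)) (fun m => orb (ym m) (σm m))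
        s a b =
      if a ≤ b then
        (if σm b = σp a then ((L : ℂ) ^ 2)⁻¹ * ∑ k : TorusSite 2 L,
          torusChar k ((ym b).toTorusSite - (yp a).toTorusSite) *
            (Complex.exp (-(s b - s a) * ((torusBand L k - μ : ℝ) : ℂ)) * (fermiFunction β (torusBand L k - μ) : ℂ))
          else 0)
      else
        -(if σm b = σp a then ((L : ℂ) ^ 2)⁻¹ * ∑ k : TorusSite 2 L,
          torusChar k ((ym b).toTorusSite - (yp a).toTorusSite) *
            (Complex.exp (-(s b - s a) * ((torusBand L k - μ : ℝ) : ℂ)) *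
              (fermiFunction (-β) (torusBand L k - μ) : ℂ))
          else 0) := by
  have e : ∀ γ : ℝ, NormedSpace.exp (-(s b • hubbardOneBody (fermionTorusGraph 2 L) 1 μ)) *
      (1 + NormedSpace.exp ((γ : ℂ) • hubbardOneBody (fermionTorusGraph 2 L) 1 μ))⁻¹ *
        NormedSpace.exp (s a • hubbardOneBody (fermionTorusGraph 2 L) 1 μ) =
      torusMultiplier fun k => Complex.exp (-(s b - s a) * ((torusBand L k - μ : ℝ) : ℂ)) *
        (fermiFunction γ (torusBand L k - μ) : ℂ) := by
    intro γ
    rw [fermiMatrix_torus_eq_freeFermiMatrix hL, freeFermiMatrix_eq_torusMultiplier,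
      show -(s b • hubbardOneBody (fermionTorusGraph 2 L) 1 μ) = (-s b) • hubbardOneBody (fermionTorusGraph 2 L) 1 μ
        from (neg_smul _ _).symm,
      exp_smul_hubbardOneBody_eq_torusMultiplier hL, exp_smul_hubbardOneBody_eq_torusMultiplier hL,
      torusMultiplier_mul, torusMultiplier_mul]
    congr 1
    funext k
    rw [mul_right_comm, ← Complex.exp_add]
    congr 2
    ring
  have hneg : -((β : ℂ) • hubbardOneBody (fermionTorusGraph 2 L) 1 μ) =
      (((-β : ℝ)) : ℂ) • hubbardOneBody (fermionTorusGraph 2 L) 1 μ := by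
    rw [Complex.ofReal_neg, neg_smul]
  simp only [propMatrix, Matrix.of_apply]
  rw [hneg, e β, e (-β), torusMultiplier_orb, torusMultiplier_orb]

omit [NeZero L] in
/-- The orbital word of `c†_{y₀s₀} c_{…} ∏ vertices` as an explicit (orbital, spin) family. [folklore] -/
theorem hubbardWordOrb_eq {Λ : Type*} {k : ℕ} (y0 : Λ) (s0 : Fin 2) (f : Fin k → Λ) :
    hubbardWordOrb (orb y0 s0) f = fun m : Fin (k * 2 + 1) =>
      orb ((Fin.cons y0 (fun m : Fin (k * 2) => f (finProdFinEquiv.symm m : Fin k × Fin 2).1) : Fin (k * 2 + 1) → Λ) m)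
        ((Fin.cons s0 (fun m : Fin (k * 2) => (finProdFinEquiv.symm m : Fin k × Fin 2).2) : Fin (k * 2 + 1) → Fin 2) m) := by
  funext m
  refine Fin.cases ?_ (fun m => ?_) m
  · simp [hubbardWordOrb]
  · simp [hubbardWordOrb]

omit [NeZero L] in
/-- Scalar match, external row: `G_β(ξ, β(1−u)) = e^{βuξ} f_β(ξ)` for `u < 1`, `β > 0` (antiperiodicity turns the
`(1−n_F)` branch at time `β(1−u)` into the `n_F` branch seen from time `β`). [folklore] -/
theorem timeOrdered_row_eq {β ξ u : ℝ} (hβ : 0 < β) (hu : u < 1) :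
    ((timeOrderedPropagator β ξ (β * (1 - u)) : ℝ) : ℂ) =
      Complex.exp (-(((u : ℝ) : ℂ) * -(β : ℂ)) * (ξ : ℂ)) * ((fermiFunction β ξ : ℝ) : ℂ) := by
  have hs : 0 < β * (1 - u) := by nlinarith
  have hR : (1 + Real.exp (-(β * ξ)))⁻¹ * Real.exp (-(ξ * (β * (1 - u)))) =
      Real.exp (β * u * ξ) * (1 / (1 + Real.exp (β * ξ))) := by
    rw [show -(ξ * (β * (1 - u))) = -(β * ξ) + β * u * ξ by ring, Real.exp_add, Real.exp_neg]
    have hpos : 0 < Real.exp (β * ξ) := Real.exp_pos _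
    field_simp
    ring
  rw [timeOrderedPropagator_of_pos β ξ hs, fermiFunction, hR]
  push_cast
  congr 1
  congr 1
  ring

omit [NeZero L] in
/-- Scalar match, external column: `G_β(ξ, −β(1−u)) = −e^{−βuξ} f_{−β}(ξ)` for `u < 1`, `β > 0`. [folklore] -/
theorem timeOrdered_col_eq {β ξ u : ℝ} (hβ : 0 < β) (hu : u < 1) :
    ((timeOrderedPropagator β ξ (0 - β * (1 - u)) : ℝ) : ℂ) =
      -(Complex.exp (-(0 - ((u : ℝ) : ℂ) * -(β : ℂ)) * (ξ : ℂ)) * ((fermiFunction (-β) ξ : ℝ) : ℂ)) := by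
  have hs : 0 - β * (1 - u) < 0 := by nlinarith
  have hR : -((1 + Real.exp (β * ξ))⁻¹ * Real.exp (-(ξ * (0 - β * (1 - u))))) =
      -(Real.exp (-(β * u * ξ)) * (1 / (1 + Real.exp (-β * ξ)))) := by
    rw [show -(ξ * (0 - β * (1 - u))) = β * ξ + -(β * u * ξ) by ring, Real.exp_add,
      show -β * ξ = -(β * ξ) by ring, Real.exp_neg (β * ξ)]
    have hpos : 0 < Real.exp (β * ξ) := Real.exp_pos _
    field_simp
    ring
  rw [timeOrderedPropagator_of_neg β ξ hs, fermiFunction, hR]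
  push_cast
  congr 2
  congr 1
  ring

/-- Scalar match on the external pair: the midpoint `½ − n_F` of the Grassmann side against the `n_F` entry of `c†c`,
with the `½[x⃗ₑ=y⃗ₑ]` correction. [folklore] -/
theorem twoPoint_corner_eq (β μ : ℝ) (σ σ' : Fin 2) (xe ye : TorusSite 2 L) :
    -(if σ = σ' then ((1 / (L : ℝ) ^ 2 : ℝ) : ℂ) * ∑ q : TorusSite 2 L,
        torusChar q (xe - ye) * ((timeOrderedPropagator β (nambuXi L μ q) (0 - 0) : ℝ) : ℂ) else 0) =
      (if σ' = σ then ((L : ℂ) ^ 2)⁻¹ * ∑ k : TorusSite 2 L, torusChar k (ye - xe) *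
          (Complex.exp (-(0 - 0) * ((torusBand L k - μ : ℝ) : ℂ)) * (fermiFunction β (torusBand L k - μ) : ℂ)) else 0) -
        (if σ = σ' ∧ xe = ye then (1 / 2 : ℂ) else 0) := by
  have hL : (L : ℂ) ≠ 0 := by exact_mod_cast NeZero.ne L
  have hL2 : ((L : ℂ) ^ 2)⁻¹ = ((1 / (L : ℝ) ^ 2 : ℝ) : ℂ) := by push_cast; rw [one_div]
  by_cases hσ : σ = σ'
  · subst hσ
    have hsplit : ∀ q : TorusSite 2 L, ((timeOrderedPropagator β (nambuXi L μ q) (0 - 0) : ℝ) : ℂ) =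
        (1 / 2 : ℂ) - Complex.exp (-(0 - 0) * ((torusBand L q - μ : ℝ) : ℂ)) *
          (fermiFunction β (torusBand L q - μ) : ℂ) := by
      intro q
      rw [sub_zero, timeOrderedPropagator_zero, nambuXi, fermiFunction]
      simp only [sub_self, neg_zero, zero_mul, Complex.exp_zero, one_mul]
      push_cast
      ring
    by_cases hxy : xe = ye
    · rw [if_pos rfl, if_pos rfl, if_pos ⟨rfl, hxy⟩, hL2, show ye - xe = -(xe - ye) by abel,
        sum_torusChar_neg_of_even _ _ (fun q => by simp only [torusBand_neg])]
      simp_rw [hsplit, mul_sub, Finset.sum_sub_distrib, Finset.mul_sum]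
      rw [← Finset.mul_sum, ← Finset.sum_mul, sum_torusChar_left, if_pos (sub_eq_zero.2 hxy)]
      push_cast
      field_simp
      ring
    · rw [if_pos rfl, if_pos rfl, if_neg (fun h => hxy h.2), hL2, show ye - xe = -(xe - ye) by abel,
        sum_torusChar_neg_of_even _ _ (fun q => by simp only [torusBand_neg])]
      simp_rw [hsplit, mul_sub, Finset.sum_sub_distrib, Finset.mul_sum]
      rw [← Finset.mul_sum, ← Finset.sum_mul, sum_torusChar_left, if_neg (fun h => hxy (sub_eq_zero.1 h))]
      ring
  · rw [if_neg hσ, if_neg (Ne.symm hσ), if_neg (fun h => hσ h.1), neg_zero, sub_zero]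

variable (L) in
/-- **The shifted Hamiltonian two-point word matrix** on the torus: `propMatrix` of the `2n+1` pairs of
`c†_{x⃗ₑσ}c_{y⃗ₑσ'} ∏_a (n_{x_a↑}−½)(n_{x_a↓}−½)(s_a)`, `s_a = −βu_a`, minus `diag(0, ½, …, ½)` (the integrand of
`hasSum_hubbard_twoPoint_renormalised_det` at `ν = ½`, sites through `ofTorusSite`). [cite: BenfattoGiulianiMastropietro2006, §2.1 (2.8)] -/
def twoPointWordMatrix (β μ : ℝ) (σ σ' : Fin 2) (xe ye : TorusSite 2 L) {n : ℕ} (x : Fin n → TorusSite 2 L)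
    (u : Fin n → ℝ) : Matrix (Fin (n * 2 + 1)) (Fin (n * 2 + 1)) ℂ :=
  propMatrix β (hubbardOneBody (fermionTorusGraph 2 L) 1 μ)
      (hubbardWordOrb (orb (FermionTorus.ofTorusSite xe) σ) fun a => FermionTorus.ofTorusSite (x a))
      (hubbardWordOrb (orb (FermionTorus.ofTorusSite ye) σ') fun a => FermionTorus.ofTorusSite (x a))
      (hubbardWordTime fun a : Fin n => ((u a : ℝ) : ℂ) * -(β : ℂ)) -
    Matrix.diagonal (Fin.cons 0 fun _ : Fin (n * 2) => ((1 / 2 : ℝ) : ℂ))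

variable (L) in
/-- **The shifted Hamiltonian vacuum matrix** (`propMatrix(x⃗, −βu) − ½·1` on the `2n` vertex pairs; the integrand of
`hasSum_hubbard_partitionFn_renormalised_det` at `ν = ½`). [cite: BenfattoGiulianiMastropietro2006, §2.1 (2.6)] -/
def vacuumWordMatrix (β μ : ℝ) {n : ℕ} (x : Fin n → TorusSite 2 L) (u : Fin n → ℝ) :
    Matrix (Fin (n * 2)) (Fin (n * 2)) ℂ :=
  propMatrix β (hubbardOneBody (fermionTorusGraph 2 L) 1 μ)
      (fun m : Fin (n * 2) => orb (FermionTorus.ofTorusSite (x (finProdFinEquiv.symm m : Fin n × Fin 2).1))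
        (finProdFinEquiv.symm m : Fin n × Fin 2).2)
      (fun m : Fin (n * 2) => orb (FermionTorus.ofTorusSite (x (finProdFinEquiv.symm m : Fin n × Fin 2).1))
        (finProdFinEquiv.symm m : Fin n × Fin 2).2)
      (fun m : Fin (n * 2) => (((u (finProdFinEquiv.symm m : Fin n × Fin 2).1 : ℝ) : ℂ) * -(β : ℂ))) -
    ((1 / 2 : ℝ) : ℂ) • (1 : Matrix (Fin (n * 2)) (Fin (n * 2)) ℂ)

/-- The vertex block of the two-point word matrix is the vacuum matrix. [folklore] -/
theorem twoPointWordMatrix_succ_succ (β μ : ℝ) (σ σ' : Fin 2) (xe ye : TorusSite 2 L) {n : ℕ}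
    (x : Fin n → TorusSite 2 L) (u : Fin n → ℝ) (m m' : Fin (n * 2)) :
    twoPointWordMatrix L β μ σ σ' xe ye x u m.succ m'.succ = vacuumWordMatrix L β μ x u m m' := by
  rw [twoPointWordMatrix, vacuumWordMatrix, Matrix.sub_apply, Matrix.sub_apply, Matrix.smul_apply, Matrix.one_apply,
    Matrix.diagonal_apply]
  have hsub := propMatrix_submatrix β (hubbardOneBody (fermionTorusGraph 2 L) 1 μ)
    (hubbardWordOrb (orb (FermionTorus.ofTorusSite xe) σ) fun a => FermionTorus.ofTorusSite (x a))
    (hubbardWordOrb (orb (FermionTorus.ofTorusSite ye) σ') fun a => FermionTorus.ofTorusSite (x a))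
    (hubbardWordTime fun a : Fin n => ((u a : ℝ) : ℂ) * -(β : ℂ)) (Fin.succOrderEmb (n * 2))
  have happ := congrFun (congrFun hsub m) m'
  simp only [Matrix.submatrix_apply, Fin.coe_succOrderEmb, Function.comp_def, hubbardWordOrb_succ,
    hubbardWordTime_succ] at happ
  rw [happ]
  simp only [Fin.succ_inj, Fin.cons_succ, smul_eq_mul, mul_ite, mul_one, mul_zero]

/-- The limiting entries of the two-point determinant are the external-time-`0` entries; unfolded. [folklore] -/
theorem twoPointLimitDet_eq (β μ : ℝ) (σ σ' : Fin 2) (xe ye : TorusSite 2 L) {n : ℕ} (x : Fin n → TorusSite 2 L)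
    (τ : Fin n → ℝ) : twoPointLimitDet L β μ σ σ' xe ye x τ = (Matrix.of fun i j : Fin (n * 2 + 1) =>
      vertexLimitEntry L β μ ((Fin.append x ![xe, ye] : Fin (n + 2) → TorusSite 2 L) (twoPointPlusEnum n σ i).1)
        ((Fin.append x ![xe, ye] : Fin (n + 2) → TorusSite 2 L) (twoPointMinusEnum n σ' j).1)
        (twoPointPlusEnum n σ i).2 (twoPointMinusEnum n σ' j).2
        ((Fin.append τ ![(0 : ℝ), 0] : Fin (n + 2) → ℝ) (twoPointMinusEnum n σ' j).1 -
          (Fin.append τ ![(0 : ℝ), 0] : Fin (n + 2) → ℝ) (twoPointPlusEnum n σ i).1)).det := rfl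

omit [NeZero L] in
/-- The configuration lookups of the extended point set. [folklore] -/
theorem append_ext_lookups {n : ℕ} (x : Fin n → TorusSite 2 L) (xe ye : TorusSite 2 L) (t : Fin n → ℝ) :
    ((Fin.append x ![xe, ye] : Fin (n + 2) → TorusSite 2 L) (Fin.natAdd n 0) = xe ∧
      (Fin.append x ![xe, ye] : Fin (n + 2) → TorusSite 2 L) (Fin.natAdd n 1) = ye ∧
      (∀ a, (Fin.append x ![xe, ye] : Fin (n + 2) → TorusSite 2 L) (Fin.castAdd 2 a) = x a)) ∧
    ((Fin.append t ![(0 : ℝ), 0] : Fin (n + 2) → ℝ) (Fin.natAdd n 0) = 0 ∧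
      (Fin.append t ![(0 : ℝ), 0] : Fin (n + 2) → ℝ) (Fin.natAdd n 1) = 0 ∧
      (∀ a, (Fin.append t ![(0 : ℝ), 0] : Fin (n + 2) → ℝ) (Fin.castAdd 2 a) = t a)) := by
  refine ⟨⟨?_, ?_, fun a => ?_⟩, ⟨?_, ?_, fun a => ?_⟩⟩ <;>
    simp only [Fin.append_right, Fin.append_left, Matrix.cons_val_zero, Matrix.cons_val_one]

/-- Match at the external pair `(0,0)`. [cite: BenfattoGiulianiMastropietro2006, §2.1 (2.3)-(2.8)] -/
theorem twoPointLimit_entry_zero_zero (hL : 3 ≤ L) (β μ : ℝ) (σ σ' : Fin 2) (xe ye : TorusSite 2 L)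
    {n : ℕ} (x : Fin n → TorusSite 2 L) (u : Fin n → ℝ) :
    vertexLimitEntry L β μ xe ye σ σ' (0 - 0) =
      twoPointWordMatrix L β μ σ σ' xe ye x u 0 0 - (if σ = σ' ∧ xe = ye then (1 / 2 : ℂ) else 0) := by
  rw [twoPointWordMatrix, hubbardWordOrb_eq, hubbardWordOrb_eq, Matrix.sub_apply, Matrix.diagonal_apply_eq,
    propMatrix_torus_orb_apply₂ hL, if_pos le_rfl, vertexLimitEntry_eq_torusChar]
  simp only [Fin.cons_zero, hubbardWordTime_zero, FermionTorus.toTorusSite_ofTorusSite, sub_zero]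
  have h := twoPoint_corner_eq (L := L) β μ σ σ' xe ye
  simp only [sub_zero] at h
  exact h

/-- Match on the external row `(0, succ m')`: minus the word entry (antiperiodicity). [cite: BenfattoGiulianiMastropietro2006, §2.1 (2.3)-(2.8)] -/
theorem twoPointLimit_entry_zero_succ (hL : 3 ≤ L) {β : ℝ} (hβ : 0 < β) (μ : ℝ) (σ σ' : Fin 2) (xe ye : TorusSite 2 L)
    {n : ℕ} (x : Fin n → TorusSite 2 L) {u : Fin n → ℝ} (hu1 : ∀ a, u a < 1) (m' : Fin (n * 2)) :
    vertexLimitEntry L β μ xe (x (finProdFinEquiv.symm m' : Fin n × Fin 2).1) σ (finProdFinEquiv.symm m' : Fin n × Fin 2).2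
        (β * (1 - u (finProdFinEquiv.symm m' : Fin n × Fin 2).1)) =
      -twoPointWordMatrix L β μ σ σ' xe ye x u 0 m'.succ := by
  have hL2 : ((L : ℂ) ^ 2)⁻¹ = ((1 / (L : ℝ) ^ 2 : ℝ) : ℂ) := by push_cast; rw [one_div]
  rw [twoPointWordMatrix, hubbardWordOrb_eq, hubbardWordOrb_eq, Matrix.sub_apply,
    Matrix.diagonal_apply_ne _ (Fin.succ_ne_zero m').symm, propMatrix_torus_orb_apply₂ hL,
    if_pos (Fin.zero_le _), vertexLimitEntry_eq_torusChar, hL2]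
  simp only [Fin.cons_zero, Fin.cons_succ, hubbardWordTime_zero, hubbardWordTime_succ,
    FermionTorus.toTorusSite_ofTorusSite, sub_zero]
  by_cases hσ : σ = (finProdFinEquiv.symm m' : Fin n × Fin 2).2
  · rw [if_pos hσ, if_pos hσ.symm,
      show xe - x (finProdFinEquiv.symm m' : Fin n × Fin 2).1 = -(x (finProdFinEquiv.symm m' : Fin n × Fin 2).1 - xe)
        by abel,
      sum_torusChar_neg_of_even _ _ (fun q => by simp only [nambuXi, torusBand_neg])]
    refine congrArg Neg.neg (congrArg _ (sum_congr rfl fun q _ => ?_))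
    exact congrArg _ (timeOrdered_row_eq hβ (hu1 _))
  · rw [if_neg hσ, if_neg (Ne.symm hσ), neg_zero]

/-- Match on the external column `(succ m, 0)`: minus the word entry (antiperiodicity). [cite: BenfattoGiulianiMastropietro2006, §2.1 (2.3)-(2.8)] -/
theorem twoPointLimit_entry_succ_zero (hL : 3 ≤ L) {β : ℝ} (hβ : 0 < β) (μ : ℝ) (σ σ' : Fin 2) (xe ye : TorusSite 2 L)
    {n : ℕ} (x : Fin n → TorusSite 2 L) {u : Fin n → ℝ} (hu1 : ∀ a, u a < 1) (m : Fin (n * 2)) :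
    vertexLimitEntry L β μ (x (finProdFinEquiv.symm m : Fin n × Fin 2).1) ye (finProdFinEquiv.symm m : Fin n × Fin 2).2 σ'
        (0 - β * (1 - u (finProdFinEquiv.symm m : Fin n × Fin 2).1)) =
      -twoPointWordMatrix L β μ σ σ' xe ye x u m.succ 0 := by
  have hL2 : ((L : ℂ) ^ 2)⁻¹ = ((1 / (L : ℝ) ^ 2 : ℝ) : ℂ) := by push_cast; rw [one_div]
  rw [twoPointWordMatrix, hubbardWordOrb_eq, hubbardWordOrb_eq, Matrix.sub_apply,
    Matrix.diagonal_apply_ne _ (Fin.succ_ne_zero m), sub_zero, propMatrix_torus_orb_apply₂ hL,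
    if_neg (not_le.2 (Fin.succ_pos m)), vertexLimitEntry_eq_torusChar, hL2, neg_neg]
  simp only [Fin.cons_zero, Fin.cons_succ, hubbardWordTime_zero, hubbardWordTime_succ,
    FermionTorus.toTorusSite_ofTorusSite]
  by_cases hσ : (finProdFinEquiv.symm m : Fin n × Fin 2).2 = σ'
  · rw [if_pos hσ, if_pos hσ.symm,
      show ye - x (finProdFinEquiv.symm m : Fin n × Fin 2).1 = -(x (finProdFinEquiv.symm m : Fin n × Fin 2).1 - ye)
        by abel,
      sum_torusChar_neg_of_even _ _ (fun q => by simp only [torusBand_neg]), ← mul_neg, ← Finset.sum_neg_distrib]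
    refine congrArg _ (sum_congr rfl fun q _ => ?_)
    rw [← mul_neg, timeOrdered_col_eq hβ (hu1 _), neg_neg]
    rfl
  · rw [if_neg hσ, if_neg (Ne.symm hσ)]
    simp

/-- Match on the vertex block: the partition-function match and the leg swap. [cite: BenfattoGiulianiMastropietro2006, §2.1 (2.3)-(2.8)] -/
theorem twoPointLimit_entry_succ_succ (hL : 3 ≤ L) {β : ℝ} (hβ : 0 < β) (μ : ℝ) (σ σ' : Fin 2) (xe ye : TorusSite 2 L)
    {n : ℕ} (x : Fin n → TorusSite 2 L) {u : Fin n → ℝ} (hu : StrictMono u) (m m' : Fin (n * 2)) :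
    vertexLimitEntry L β μ (x (finProdFinEquiv.symm m : Fin n × Fin 2).1) (x (finProdFinEquiv.symm m' : Fin n × Fin 2).1)
        (finProdFinEquiv.symm m : Fin n × Fin 2).2 (finProdFinEquiv.symm m' : Fin n × Fin 2).2
        (β * (1 - u (finProdFinEquiv.symm m' : Fin n × Fin 2).1) - β * (1 - u (finProdFinEquiv.symm m : Fin n × Fin 2).1)) =
      twoPointWordMatrix L β μ σ σ' xe ye x u m.succ m'.succ := by
  rw [twoPointWordMatrix_succ_succ, vacuumWordMatrix, propMatrix_sub_half_eq_transpose_vertexLimit hL hβ μ x hu m m',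
    vertexLimitEntry_swap]
  congr 1
  simp only [Pi.smul_apply, smul_eq_mul]
  ring

/-- **The entrywise match on the open simplex** (`L ≥ 3`, `β > 0`, `u` strictly increasing with `u_a < 1`, vertex
times `τ_a = β(1 − u_a)`, external time `0`): the Grassmann limit matrix is `ε_i ε_j` times the shifted Hamiltonian
word matrix corrected by `½[σ=σ'][x⃗ₑ=y⃗ₑ]` at the external pair — `ε = (−1, 1, …, 1)`.
[cite: BenfattoGiulianiMastropietro2006, §2.1 (2.3)-(2.8)] -/
theorem twoPointLimit_entry_eq (hL : 3 ≤ L) {β : ℝ} (hβ : 0 < β) (μ : ℝ) (σ σ' : Fin 2) (xe ye : TorusSite 2 L)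
    {n : ℕ} (x : Fin n → TorusSite 2 L) {u : Fin n → ℝ} (hu : StrictMono u) (hu1 : ∀ a, u a < 1)
    (i j : Fin (n * 2 + 1)) :
    vertexLimitEntry L β μ ((Fin.append x ![xe, ye] : Fin (n + 2) → TorusSite 2 L) (twoPointPlusEnum n σ i).1)
        ((Fin.append x ![xe, ye] : Fin (n + 2) → TorusSite 2 L) (twoPointMinusEnum n σ' j).1)
        (twoPointPlusEnum n σ i).2 (twoPointMinusEnum n σ' j).2
        ((Fin.append (fun a => β * (1 - u a)) ![(0 : ℝ), 0] : Fin (n + 2) → ℝ) (twoPointMinusEnum n σ' j).1 -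
          (Fin.append (fun a => β * (1 - u a)) ![(0 : ℝ), 0] : Fin (n + 2) → ℝ) (twoPointPlusEnum n σ i).1) =
      (Fin.cons (-1 : ℂ) (fun _ : Fin (n * 2) => (1 : ℂ)) : Fin (n * 2 + 1) → ℂ) i *
        (Fin.cons (-1 : ℂ) (fun _ : Fin (n * 2) => (1 : ℂ)) : Fin (n * 2 + 1) → ℂ) j *
        (twoPointWordMatrix L β μ σ σ' xe ye x u i j - if i = 0 ∧ j = 0 then
          (if σ = σ' ∧ xe = ye then (1 / 2 : ℂ) else 0) else 0) := by
  obtain ⟨⟨hx0, hx1, hxa⟩, ⟨ht0, ht1, hta⟩⟩ := append_ext_lookups x xe ye (fun a => β * (1 - u a))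
  refine Fin.cases ?_ (fun m => ?_) i <;> refine Fin.cases ?_ (fun m' => ?_) j
  · simp only [twoPointPlusEnum_zero, twoPointMinusEnum_zero, hx0, hx1, ht0, ht1, Fin.cons_zero, true_and, if_true]
    rw [twoPointLimit_entry_zero_zero hL β μ σ σ' xe ye x u]
    ring
  · simp only [twoPointPlusEnum_zero, twoPointMinusEnum_succ, hx0, hxa, ht0, hta, Fin.cons_zero, Fin.cons_succ,
      Fin.succ_ne_zero, and_false, if_false, sub_zero]
    rw [twoPointLimit_entry_zero_succ hL hβ μ σ σ' xe ye x hu1 m']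
    ring
  · simp only [twoPointPlusEnum_succ, twoPointMinusEnum_zero, hx1, hxa, ht1, hta, Fin.cons_zero, Fin.cons_succ,
      Fin.succ_ne_zero, false_and, if_false, sub_zero]
    rw [twoPointLimit_entry_succ_zero hL hβ μ σ σ' xe ye x hu1 m]
    ring
  · simp only [twoPointPlusEnum_succ, twoPointMinusEnum_succ, hxa, hta, Fin.cons_succ, Fin.succ_ne_zero, false_and,
      if_false, sub_zero, one_mul]
    exact twoPointLimit_entry_succ_succ hL hβ μ σ σ' xe ye x hu m m'

/-- `det(A − c·E₀₀) = det A − c·det A₁₁` for the single-entry matrix `E₀₀` (Laplace along row `0`). [folklore] -/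
theorem det_sub_corner {m : ℕ} (A : Matrix (Fin (m + 1)) (Fin (m + 1)) ℂ) (c : ℂ) :
    (Matrix.of fun i j : Fin (m + 1) => A i j - if i = 0 ∧ j = 0 then c else 0).det =
      A.det - c * (A.submatrix Fin.succ Fin.succ).det := by
  rw [Matrix.det_succ_row_zero, Matrix.det_succ_row_zero A]
  have hsub : ∀ j : Fin (m + 1),
      (Matrix.of fun i j : Fin (m + 1) => A i j - if i = 0 ∧ j = 0 then c else 0).submatrix Fin.succ j.succAbove =
        A.submatrix Fin.succ j.succAbove := by
    intro j
    ext a b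
    simp [Matrix.submatrix_apply, Fin.succ_ne_zero]
  simp_rw [hsub]
  rw [Fin.sum_univ_succ, Fin.sum_univ_succ]
  simp only [Matrix.of_apply, true_and, if_true, Fin.succ_ne_zero, and_false, if_false, sub_zero, Fin.val_zero,
    pow_zero, one_mul, Fin.succAbove_zero]
  ring

/-- Sign flips of row and column `0` do not change the determinant. [folklore] -/
theorem det_cons_sign_mul {m : ℕ} (A : Matrix (Fin (m + 1)) (Fin (m + 1)) ℂ) :
    (Matrix.of fun i j : Fin (m + 1) => (Fin.cons (-1 : ℂ) (fun _ : Fin m => (1 : ℂ)) : Fin (m + 1) → ℂ) i *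
        (Fin.cons (-1 : ℂ) (fun _ : Fin m => (1 : ℂ)) : Fin (m + 1) → ℂ) j * A i j).det = A.det := by
  have hprod : ∏ i : Fin (m + 1), (Fin.cons (-1 : ℂ) (fun _ : Fin m => (1 : ℂ)) : Fin (m + 1) → ℂ) i = -1 := by
    rw [Fin.prod_univ_succ]
    simp
  have h1 : (Matrix.of fun i j : Fin (m + 1) => (Fin.cons (-1 : ℂ) (fun _ : Fin m => (1 : ℂ)) : Fin (m + 1) → ℂ) i *
      (Fin.cons (-1 : ℂ) (fun _ : Fin m => (1 : ℂ)) : Fin (m + 1) → ℂ) j * A i j) =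
      Matrix.of fun i j : Fin (m + 1) => (Fin.cons (-1 : ℂ) (fun _ : Fin m => (1 : ℂ)) : Fin (m + 1) → ℂ) i *
        (Matrix.of fun i j : Fin (m + 1) => (Fin.cons (-1 : ℂ) (fun _ : Fin m => (1 : ℂ)) : Fin (m + 1) → ℂ) j *
          A i j) i j := by
    ext i j
    simp only [Matrix.of_apply, mul_assoc]
  rw [h1, Matrix.det_mul_column, Matrix.det_mul_row, hprod]
  ring

/-- **The limiting two-point determinant on the open simplex is the shifted Hamiltonian determinant minus the
midpoint correction**: `twoPointLimitDet x (β(1−u)) = det(twoPointWordMatrix x u) − ½[σ=σ'][x⃗ₑ=y⃗ₑ]·det(vacuumWordMatrix x u)`.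
[cite: BenfattoGiulianiMastropietro2006, §2.1 (2.6)-(2.8)] -/
theorem twoPointLimitDet_reflect_eq (hL : 3 ≤ L) {β : ℝ} (hβ : 0 < β) (μ : ℝ) (σ σ' : Fin 2) (xe ye : TorusSite 2 L)
    {n : ℕ} (x : Fin n → TorusSite 2 L) {u : Fin n → ℝ} (hu : StrictMono u) (hu1 : ∀ a, u a < 1) :
    twoPointLimitDet L β μ σ σ' xe ye x (fun a => β * (1 - u a)) =
      (twoPointWordMatrix L β μ σ σ' xe ye x u).det -
        (if σ = σ' ∧ xe = ye then (1 / 2 : ℂ) else 0) * (vacuumWordMatrix L β μ x u).det := by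
  rw [twoPointLimitDet]
  have hmat : (Matrix.of fun i j : Fin (n * 2 + 1) =>
      vertexLimitEntry L β μ ((Fin.append x ![xe, ye] : Fin (n + 2) → TorusSite 2 L) (twoPointPlusEnum n σ i).1)
        ((Fin.append x ![xe, ye] : Fin (n + 2) → TorusSite 2 L) (twoPointMinusEnum n σ' j).1)
        (twoPointPlusEnum n σ i).2 (twoPointMinusEnum n σ' j).2
        ((Fin.append (fun a => β * (1 - u a)) ![(0 : ℝ), 0] : Fin (n + 2) → ℝ) (twoPointMinusEnum n σ' j).1 -
          (Fin.append (fun a => β * (1 - u a)) ![(0 : ℝ), 0] : Fin (n + 2) → ℝ) (twoPointPlusEnum n σ i).1)) =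
      Matrix.of fun i j : Fin (n * 2 + 1) =>
        (Fin.cons (-1 : ℂ) (fun _ : Fin (n * 2) => (1 : ℂ)) : Fin (n * 2 + 1) → ℂ) i *
          (Fin.cons (-1 : ℂ) (fun _ : Fin (n * 2) => (1 : ℂ)) : Fin (n * 2 + 1) → ℂ) j *
          (Matrix.of fun i j : Fin (n * 2 + 1) => twoPointWordMatrix L β μ σ σ' xe ye x u i j -
            if i = 0 ∧ j = 0 then (if σ = σ' ∧ xe = ye then (1 / 2 : ℂ) else 0) else 0) i j := by
    ext i j
    simp only [Matrix.of_apply]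
    exact twoPointLimit_entry_eq hL hβ μ σ σ' xe ye x hu hu1 i j
  rw [hmat, det_cons_sign_mul, det_sub_corner]
  congr 2
  congr 1
  ext m m'
  simp only [Matrix.submatrix_apply, twoPointWordMatrix_succ_succ]

end Match

end Literature.MathematicalPhysics.QuantumLattice
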